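import Literature.NumberTheory.Sieve.LargestPrimeFactorCubicTBound
import Literature.NumberTheory.Sieve.LargestPrimeFactorCubicSmallPart
import Literature.NumberTheory.Sieve.LargestPrimeFactorCubicProofs
import Mathlib.Analysis.SpecialFunctions.Pow.Real
import HarnessLib

/-!
# Heath-Brown's Lemma 2.2 (Chebyshev–Hooley accounting, this seat's version) and the assembly of
# Irving 2015, Theorem 1.1 from its sieve-theoretic inputs

Proved layers three and six under the named fact `Irving2015_largestPrimeFactor_cubic`
(`LargestPrimeFactorCubic.lean`; A. J. Irving, arXiv:1412.0024 = Acta Arith. 171 (2015),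
Thm. 1.1).

HISTORY (race of 2026-08-15).  The first part of this file — Heath-Brown's Lemma 2 = Irving's
Lemma 2.2 in rational form, `Irving2015.heathBrown_lemma_2_2`, with its helpers — was landed as
p46856 at `LargestPrimeFactorCubicChebyshev.lean` and displaced there one commit later by the
parallel, independent proof p46793 of the same lemma (namespace `LargestPrimeFactorCubic`, files
`…Local/Mertens/SmoothSum/Chebyshev`), whose module docstring records the race and asks for the
displaced declarations to be re-landed; they are re-landed HERE, verbatim up to the move, so the
two developments coexist (different namespaces, different constants: `α²δ/(2(1+δ))` with an
explicit `X₀` here, Heath-Brown's `δα² − o(1)` there).  This file depends only on this seat's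
chain (`…Proofs`, `…SmallPart`, `…DivisorSet`, `…TBound`).

Contents:

* `Irving2015.heathBrown_lemma_2_2` — for `α, δ > 0` there is `X₀` such that for `X ≥ X₀`, if
  `αX ≤ #{n ∈ (X,2X] : σ(n) ≥ (1+δ) log X}`, `σ(n) = ∑_{p≤3X} v_p(n³+2) log p`
  (`= log^{(1)}(n³+2)` by Irving's Lemma 2.1), then
  `α²δ/(2(1+δ))·X ≤ #{n ∈ (X,2X] : ∃ p prime, p ∣ n³+2, p ≥ X^{1+αδ/2}}`.
  Proof: the large parts `λ(n) = log(n³+2) − σ(n)` sum to `≥ 2X log X − O(X)`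
  (`exists_sum_smallPart_le`); `λ(n) ≤ 2(1+η) log X` if `n³+2` has no prime factor
  `≥ X^{1+η}` (the primes `> 3X` dividing `n³+2 ≤ 10X³ < (3X+1)³` have total multiplicity
  `≤ 2`, `log_sub_smallPart_le_two_mul_log`), `≤ (2−δ) log X + log 10` for the good `n`,
  `≤ 3 log X + log 10` always; with `η = αδ/2` the books balance only if
  `P(1+δ) log X ≥ α²δ X log X − (C + α log 10)X` (`accounting`).
* `Irving2015_largestPrimeFactor_cubic_of_sieveInputs` — ASSEMBLY of Irving's §2 and §5: the
  named fact follows from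
  (A) Heath-Brown's sieve output in rational form: for all large `X`, weights `W(n) ∈ ℕ` on
  `(X, 2X]` with `∑ W ≥ (9.2·10⁻⁸ − 10⁻⁹)X`, `W(n) > 0 ⇒ σ(n) ≥ (1 + 1/321) log X`,
  `W(n) ≤ min(Ω(n), 321)·2^{Ω(n)}` (`Ω(n) = Ω_{1/321}(n³+2)`) — his Lemma 2.3 with the
  "sufficient condition" and Irving's bound on the weights; and
  (B) Irving's tail bound `∑_{132<h≤963} min(h,321) 2^h T(h) ≤ (3.7·10⁻⁸ + 10⁻⁹)X`;
  via `card_largePrimeFactors_lt` (`Ω ≤ 963` once `X^{1/321} > 10`), `sum_weight_le`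
  (`H = 132`: `#{W>0} ≥ α₀X`, `α₀ = 2^{-132}/132·5.3·10⁻⁸`), `heathBrown_lemma_2_2`,
  `α₀δ/2 > 10⁻⁵²` and `Irving2015_largestPrimeFactor_cubic_of_count_ge`.
* `Irving2015_largestPrimeFactor_cubic_of_sieveInputs'` — the same with the tail `190 ≤ h ≤ 963`
  of (B) discharged by the proved Lemma 3.2 (`Irving2015.irving_lemma_3_2`, `…TBound.lean`): the
  named fact follows from (A), (B') `∑_{132<h≤189} min(h,321) 2^h T(h) ≤ (3.6·10⁻⁸ + 10⁻¹⁰)X` for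
  large `X` (Irving's Lemma 4.2 with `K = [h/3]+20` and optimised `α_k`, §5 — not in the tree),
  and (N) the numerical inequality `∑_{189<h≤963} min(h,321) 2^h c(h,1/321) ≤ 9.2·10⁻¹⁰`,
  `c(h,δ) = (log((3−(k−1)δ)/((h−k+1)δ)))^k/k!`, `k = [h/3]` (the left side evaluates to
  `9.138…·10⁻¹⁰`).  Proof: Lemma 3.2 with `ε₀ = 5·10⁻¹⁰/(321·2⁹⁶⁴)` for each `h`
  (`Filter.eventually_all_finset`), `∑_{h≤963} min(h,321)2^h ≤ 321·2⁹⁶⁴`, and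
  `3.6·10⁻⁸ + 10⁻¹⁰ + 9.2·10⁻¹⁰ + 5·10⁻¹⁰ ≤ 3.7·10⁻⁸ + 10⁻⁹`; the hypothesis
  `(h−k+1)δ ≤ 3−(k−1)δ` of Lemma 3.2 is `h ≤ 963` for `δ = 1/321`.

Inputs (A) and (B')+(N) are exactly what is not in the tree.

## References

* A. J. Irving, *The largest prime factor of `X³ + 2`*, arXiv:1412.0024; Acta Arith. 171 (2015)
  67–80, §2 (Lemma 2.2) and §5. [`Irving2014LargestPrimeFactorCubic`]
* D. R. Heath-Brown, *The largest prime factor of `X³ + 2`*, Proc. London Math. Soc. (3) 82 (2001)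
  554–596, Lemmas 2–3. [`HeathBrown2001LargestPrimeFactorCubic`]
-/

noncomputable section

open Finset Real Filter
open scoped Nat

namespace Literature.NumberTheory.Sieve

namespace Irving2015

/-! ### `log(n³+2)` and its small and large parts as sums over prime factors -/

/-- `log m = ∑_{p ∣ m} v_p(m) log p`. [folklore] -/
theorem log_eq_sum_primeFactors (m : ℕ) :
    Real.log m = ∑ p ∈ m.primeFactors, ((m.factorization p : ℕ) : ℝ) * Real.log p := by
  rw [Real.log_nat_eq_sum_factorization]
  rfl

/-- The small part is the sum over the prime factors `p ≤ 3X`. [folklore] -/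
theorem smallPart_eq_sum_primeFactors (X n : ℕ) :
    (∑ p ∈ Nat.primesLE (3 * X), ((n ^ 3 + 2).factorization p : ℝ) * Real.log p)
          = ∑ p ∈ ((n ^ 3 + 2).primeFactors.filter (fun p : ℕ => p ≤ 3 * X) : Finset ℕ),
      (((n ^ 3 + 2).factorization p : ℕ) : ℝ) * Real.log p := by
  symm
  apply sum_subset
  · intro p hp
    rw [mem_filter, Nat.mem_primeFactors] at hp
    exact Nat.mem_primesLE.2 ⟨hp.2, hp.1.1⟩
  · intro p hp hnot
    have hpp := Nat.mem_primesLE.1 hp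
    have hnp : p ∉ (n ^ 3 + 2).primeFactors := fun h => hnot (mem_filter.2 ⟨h, hpp.1⟩)
    rw [← Nat.support_factorization, Finsupp.notMem_support_iff] at hnp
    rw [hnp]
    simp

/-- The large part `log(n³+2) − σ(n) = ∑_{p ∣ n³+2, p > 3X} v_p log p`. [folklore] -/
theorem log_sub_smallPart_eq (X n : ℕ) :
    Real.log ((n ^ 3 + 2 : ℕ) : ℝ) -
          (∑ p ∈ Nat.primesLE (3 * X), ((n ^ 3 + 2).factorization p : ℝ) * Real.log p) =
      ∑ p ∈ ((n ^ 3 + 2).primeFactors.filter (fun p : ℕ => 3 * X < p) : Finset ℕ),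
        (((n ^ 3 + 2).factorization p : ℕ) : ℝ) * Real.log p := by
  rw [log_eq_sum_primeFactors, smallPart_eq_sum_primeFactors]
  have h := sum_filter_add_sum_filter_not (n ^ 3 + 2).primeFactors (fun p : ℕ => p ≤ 3 * X)
    (fun p : ℕ => (((n ^ 3 + 2).factorization p : ℕ) : ℝ) * Real.log p)
  have hc : (n ^ 3 + 2).primeFactors.filter (fun p : ℕ => ¬ p ≤ 3 * X) =
      (n ^ 3 + 2).primeFactors.filter (fun p : ℕ => 3 * X < p) :=
    filter_congr (fun p _ => by simp [not_le])
  rw [hc] at h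
  linarith

/-- The small part is nonnegative. [folklore] -/
theorem smallPart_nonneg (X n : ℕ) : 0 ≤
      (∑ p ∈ Nat.primesLE (3 * X), ((n ^ 3 + 2).factorization p : ℝ) * Real.log p) :=
  sum_nonneg fun p hp => mul_nonneg (Nat.cast_nonneg _)
    (Real.log_nonneg (by exact_mod_cast (Nat.mem_primesLE.1 hp).2.one_lt.le))

/-- The large part is nonnegative. [folklore] -/
theorem smallPart_le_log (X n : ℕ) :
      (∑ p ∈ Nat.primesLE (3 * X), ((n ^ 3 + 2).factorization p : ℝ) * Real.log p) ≤
        Real.log ((n ^ 3 + 2 : ℕ) : ℝ) := by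
  have h := log_sub_smallPart_eq X n
  have : 0 ≤ ∑ p ∈ ((n ^ 3 + 2).primeFactors.filter (fun p : ℕ => 3 * X < p) : Finset ℕ),
      (((n ^ 3 + 2).factorization p : ℕ) : ℝ) * Real.log p :=
    sum_nonneg fun p hp => mul_nonneg (Nat.cast_nonneg _)
      (Real.log_nonneg (by
        exact_mod_cast (Nat.prime_of_mem_primeFactors (mem_filter.1 hp).1).one_lt.le))
  linarith

/-- `3 log X ≤ log(n³ + 2) ≤ 3 log X + log 10` for `n ∈ (X, 2X]`. [folklore] -/
theorem log_cube_add_two_bounds {X n : ℕ} (hn : n ∈ Ioc X (2 * X)) :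
    3 * Real.log X ≤ Real.log ((n ^ 3 + 2 : ℕ) : ℝ) ∧
      Real.log ((n ^ 3 + 2 : ℕ) : ℝ) ≤ 3 * Real.log X + Real.log 10 := by
  rw [mem_Ioc] at hn
  have hX : 1 ≤ X := by omega
  have hX0 : (0 : ℝ) < X := by exact_mod_cast hX
  have e3 : 3 * Real.log X = Real.log ((X : ℝ) ^ 3) := by rw [Real.log_pow]; norm_num
  constructor
  · rw [e3]
    refine Real.log_le_log (by positivity) ?_
    have : X ^ 3 ≤ n ^ 3 + 2 := (Nat.pow_le_pow_left hn.1.le 3).trans (Nat.le_add_right _ _)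
    exact_mod_cast this
  · rw [e3, ← Real.log_mul (by positivity) (by norm_num)]
    refine Real.log_le_log (by positivity) ?_
    have : n ^ 3 + 2 ≤ X ^ 3 * 10 := by
      have h2 := Nat.pow_le_pow_left hn.2 3
      have hx3 : 1 ≤ X ^ 3 := Nat.one_le_pow _ _ hX
      have e1 : (2 * X) ^ 3 = 8 * X ^ 3 := by ring
      rw [e1] at h2; generalize X ^ 3 = Y at h2 hx3 ⊢; omega
    exact_mod_cast this

/-- **At most two prime factors beyond `3X`, each below `Y`**: if every prime factor of `n³ + 2`
(`n ∈ (X, 2X]`) is `< Y` (`Y ≥ 1`), then the large part is `≤ 2 log Y` — the primes `> 3X`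
dividing `n³ + 2 ≤ 10X³ < (3X+1)³` have total multiplicity at most `2`.
[cite: Irving2014LargestPrimeFactorCubic, Lemma 2.2 (= Heath-Brown 2001, Lemma 2)] -/
theorem log_sub_smallPart_le_two_mul_log {X n : ℕ} (hn : n ∈ Ioc X (2 * X)) {Y : ℝ}
    (hY1 : 1 ≤ Y)
    (hY : ∀ p : ℕ, p.Prime → p ∣ n ^ 3 + 2 → (p : ℝ) < Y) :
    Real.log ((n ^ 3 + 2 : ℕ) : ℝ) -
          (∑ p ∈ Nat.primesLE (3 * X), ((n ^ 3 + 2).factorization p : ℝ) * Real.log p)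
          ≤ 2 * Real.log Y := by
  rw [log_sub_smallPart_eq]
  rw [mem_Ioc] at hn
  have hX : 1 ≤ X := by omega
  set m := n ^ 3 + 2 with hm
  have hm0 : m ≠ 0 := by positivity
  set T := m.primeFactors.filter (fun p : ℕ => 3 * X < p) with hT
  -- total multiplicity of the primes `> 3X` is at most `2`
  have ht : ∑ p ∈ T, m.factorization p ≤ 2 := by
    have hQdvd : ∏ p ∈ T, p ^ m.factorization p ∣ m := by
      have hself : ∏ p ∈ m.primeFactors, p ^ m.factorization p = m :=
        Nat.prod_factorization_pow_eq_self hm0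
      conv_rhs => rw [← hself]
      exact prod_dvd_prod_of_subset _ _ _ (filter_subset _ _)
    have hQle : ∏ p ∈ T, p ^ m.factorization p ≤ 10 * X ^ 3 := by
      refine (Nat.le_of_dvd (by positivity) hQdvd).trans ?_
      have h2 := Nat.pow_le_pow_left hn.2 3
      have hx3 : 1 ≤ X ^ 3 := Nat.one_le_pow _ _ hX
      have e1 : (2 * X) ^ 3 = 8 * X ^ 3 := by ring
      rw [hm]; rw [e1] at h2; generalize X ^ 3 = Z at h2 hx3 ⊢; omega
    have hQge : (3 * X + 1) ^ (∑ p ∈ T, m.factorization p) ≤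
        ∏ p ∈ T, p ^ m.factorization p := by
      rw [← prod_pow_eq_pow_sum]
      refine prod_le_prod (fun p _ => Nat.zero_le _) (fun p hp => ?_)
      exact Nat.pow_le_pow_left (by have := (mem_filter.1 hp).2; omega) _
    have hlt : (3 * X + 1) ^ (∑ p ∈ T, m.factorization p) < (3 * X + 1) ^ 3 := by
      refine lt_of_le_of_lt (hQge.trans hQle) ?_
      have : 10 * X ^ 3 < (3 * X + 1) ^ 3 := by nlinarith [Nat.one_le_pow 3 X hX]
      exact this
    have := (Nat.pow_lt_pow_iff_right (by omega : 1 < 3 * X + 1)).1 hlt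
    omega
  have hlogY : 0 ≤ Real.log Y := Real.log_nonneg hY1
  calc ∑ p ∈ T, ((m.factorization p : ℕ) : ℝ) * Real.log p
      ≤ ∑ p ∈ T, ((m.factorization p : ℕ) : ℝ) * Real.log Y := by
        refine sum_le_sum (fun p hp => ?_)
        have hpf := (mem_filter.1 hp).1
        have hpp := Nat.prime_of_mem_primeFactors hpf
        refine mul_le_mul_of_nonneg_left ?_ (Nat.cast_nonneg _)
        exact Real.log_le_log (by exact_mod_cast hpp.pos)
          (hY p hpp (Nat.dvd_of_mem_primeFactors hpf)).le
    _ = ((∑ p ∈ T, m.factorization p : ℕ) : ℝ) * Real.log Y := by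
        rw [← sum_mul]; push_cast; rfl
    _ ≤ 2 * Real.log Y := by
        refine mul_le_mul_of_nonneg_right ?_ hlogY
        exact_mod_cast ht

/-! ### The accounting -/

/-- The real-arithmetic core of Heath-Brown's Lemma 2.2 (Chebyshev–Hooley accounting): with
`L = log X`, `P = #{n with a prime factor ≥ X^{1+η}}`, `g`/`r` the numbers of the remaining good /
other `n`, `Σ` the total large part, `η = αδ/2`, `c₁₀ = log 10`. [folklore] -/
theorem accounting {X L P g r S α δ η C c : ℝ} (hL : 0 < L) (hδ : 0 < δ)
    (hη : η = α * δ / 2) (hX0 : 0 ≤ X)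
    (hlow : 2 * X * L - C * X ≤ S)
    (hup : S ≤ P * (3 * L + c) + g * ((2 - δ) * L + c) + r * (2 * (1 + η) * L))
    (hr : r = X - P - g) (hg : α * X - P ≤ g) (hcoef : c ≤ (δ + 2 * η) * L)
    (hLbig : 2 * (C + α * c) ≤ α ^ 2 * δ * L) :
    α ^ 2 * δ / (2 * (1 + δ)) * X ≤ P := by
  subst hr
  have h1 : g * ((2 - δ) * L + c - 2 * (1 + η) * L) ≤
      (α * X - P) * ((2 - δ) * L + c - 2 * (1 + η) * L) :=
    mul_le_mul_of_nonpos_right hg (by nlinarith)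
  have h2 : S ≤ P * (3 * L + c) + X * (2 * (1 + η) * L) - P * (2 * (1 + η) * L) +
      (α * X - P) * ((2 - δ) * L + c - 2 * (1 + η) * L) := by nlinarith
  subst hη
  have h3 : α ^ 2 * δ * X * L - (C + α * c) * X ≤ (1 + δ) * P * L := by nlinarith
  have h4 : (C + α * c) * X ≤ α ^ 2 * δ / 2 * L * X := by nlinarith
  have h5 : (α ^ 2 * δ / 2 * X) * L ≤ ((1 + δ) * P) * L := by nlinarith
  have h6 : α ^ 2 * δ / 2 * X ≤ (1 + δ) * P := le_of_mul_le_mul_right h5 hL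
  rw [div_mul_eq_mul_div, div_le_iff₀ (by positivity)]
  nlinarith

/-! ### Heath-Brown's Lemma 2.2 (rational form) -/

open scoped Classical in
/-- **Heath-Brown 2001, Lemma 2 = Irving 2015, Lemma 2.2**, in rational terms and with the
constant `α²δ/(2(1+δ))` in place of the printed `δα² + o(1)` (any positive constant suffices
for Theorem 1.1): for `α, δ > 0` there is `X₀` such that for every `X ≥ X₀`, if at least `αX` of
the `n ∈ (X, 2X]` have `∑_{p ≤ 3X} v_p(n³+2) log p ≥ (1+δ) log X` (Heath-Brown's
`log^{(1)}(n³+2) ≥ (1+δ) log X`), then at least `α²δ/(2(1+δ))·X` of the `n ∈ (X, 2X]` have a prime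
factor `p ≥ X^{1+αδ/2}` of `n³ + 2`.  Proof (Chebyshev–Hooley): the large parts
`log(n³+2) − σ` sum to `≥ 2X log X − O(X)` (`exists_sum_smallPart_le`); an `n` without prime
factor `≥ X^{1+η}` has large part `≤ 2(1+η) log X` (`log_sub_smallPart_le_two_mul_log`), a good
one `≤ (2−δ) log X + log 10`, any `n` at most `3 log X + log 10`; with `η = αδ/2` the books
balance only if `≥ (α²δ/(1+δ) − o(1))X` of the `n` have such a prime factor (`accounting`).
[cite: Irving2014LargestPrimeFactorCubic, Lemma 2.2]
[cite: HeathBrown2001LargestPrimeFactorCubic, Lemma 2] -/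
theorem heathBrown_lemma_2_2 {α δ : ℝ} (hα : 0 < α) (hδ : 0 < δ) :
    ∃ X₀ : ℕ, ∀ X : ℕ, X₀ ≤ X →
      α * X ≤ #((Ioc X (2 * X)).filter fun n : ℕ => (1 + δ) * Real.log X ≤
            (∑ p ∈ Nat.primesLE (3 * X), ((n ^ 3 + 2).factorization p : ℝ) * Real.log p)) →
        α ^ 2 * δ / (2 * (1 + δ)) * X ≤
          #((Ioc X (2 * X)).filter fun n : ℕ =>
            ∃ p : ℕ, p.Prime ∧ p ∣ n ^ 3 + 2 ∧ (X : ℝ) ^ (1 + α * δ / 2) ≤ p) := by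
  obtain ⟨C, hC⟩ := exists_sum_smallPart_le
  have hη0 : 0 < α * δ / 2 := by positivity
  set K : ℝ := max (Real.log 10 / (δ + 2 * (α * δ / 2)))
    (2 * (C + α * Real.log 10) / (α ^ 2 * δ)) with hK
  refine ⟨⌈Real.exp K⌉₊ + 2, fun X hX hG => ?_⟩
  -- `X`, `log X`, the two largeness conditions
  have hX2 : 2 ≤ X := le_of_add_le_right hX
  have hX1 : 1 ≤ X := by omega
  have hXr : (2 : ℝ) ≤ X := by exact_mod_cast hX2
  have hXpos : (0 : ℝ) < X := by linarith
  have hL0 : 0 < Real.log X := Real.log_pos (by linarith)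
  have hKL : K ≤ Real.log X := by
    have h1 : Real.exp K ≤ X := by
      have h3 := Nat.le_ceil (Real.exp K)
      have h2 : ((⌈Real.exp K⌉₊ + 2 : ℕ) : ℝ) ≤ X := by exact_mod_cast hX
      push_cast at h2
      linarith
    exact (Real.le_log_iff_exp_le hXpos).2 h1
  have hcoef : Real.log 10 ≤ (δ + 2 * (α * δ / 2)) * Real.log X := by
    have h := (le_max_left _ _).trans hKL
    rw [div_le_iff₀ (by positivity)] at h
    linarith
  have hLbig : 2 * (C + α * Real.log 10) ≤ α ^ 2 * δ * Real.log X := by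
    have h := (le_max_right _ _).trans hKL
    rw [div_le_iff₀ (by positivity)] at h
    linarith
  have hsmall := hC X hX1
  -- the exponent `1 + η`
  have hY1 : (1 : ℝ) ≤ (X : ℝ) ^ (1 + α * δ / 2) :=
    Real.one_le_rpow (by linarith) (by linarith)
  have hlogY : Real.log ((X : ℝ) ^ (1 + α * δ / 2)) = (1 + α * δ / 2) * Real.log X :=
    Real.log_rpow hXpos _
  -- the sets
  set S := Ioc X (2 * X) with hS
  set Pset := S.filter (fun n : ℕ => ∃ p : ℕ, p.Prime ∧ p ∣ n ^ 3 + 2 ∧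
    (X : ℝ) ^ (1 + α * δ / 2) ≤ p) with hPset
  set NP := S.filter (fun n : ℕ => ¬ ∃ p : ℕ, p.Prime ∧ p ∣ n ^ 3 + 2 ∧
    (X : ℝ) ^ (1 + α * δ / 2) ≤ p) with hNP
  set G := S.filter (fun n : ℕ => (1 + δ) * Real.log X ≤
        (∑ p ∈ Nat.primesLE (3 * X), ((n ^ 3 + 2).factorization p : ℝ) * Real.log p)) with hGdef
  set GP := NP.filter (fun n : ℕ => (1 + δ) * Real.log X ≤
        (∑ p ∈ Nat.primesLE (3 * X), ((n ^ 3 + 2).factorization p : ℝ) * Real.log p)) with hGP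
  set RP := NP.filter (fun n : ℕ => ¬ (1 + δ) * Real.log X ≤
        (∑ p ∈ Nat.primesLE (3 * X), ((n ^ 3 + 2).factorization p : ℝ) * Real.log p)) with hRP
  -- cardinalities
  have hcardS : #S = X := by rw [hS, Nat.card_Ioc]; omega
  have hc1 : #Pset + #NP = #S := card_filter_add_card_filter_not _
  have hc2 : #GP + #RP = #NP := card_filter_add_card_filter_not _
  have hc3 : #G ≤ #GP + #Pset := by
    calc #G ≤ #(GP ∪ Pset) := by
          refine card_le_card (fun n hn => ?_)
          rw [hGdef, mem_filter] at hn
          rw [mem_union]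
          by_cases h :
              ∃ p : ℕ, p.Prime ∧ p ∣ n ^ 3 + 2 ∧ (X : ℝ) ^ (1 + α * δ / 2) ≤ p
          · exact Or.inr (mem_filter.2 ⟨hn.1, h⟩)
          · exact Or.inl (mem_filter.2 ⟨mem_filter.2 ⟨hn.1, h⟩, hn.2⟩)
      _ ≤ #GP + #Pset := card_union_le _ _
  -- the total large part: lower bound
  have hlow : 2 * (X : ℝ) * Real.log X - C * X ≤
      ∑ n ∈ S, (Real.log ((n ^ 3 + 2 : ℕ) : ℝ) -
            (∑ p ∈ Nat.primesLE (3 * X), ((n ^ 3 + 2).factorization p : ℝ) * Real.log p)) := by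
    have h1 : ∑ n ∈ S, 3 * Real.log X ≤ ∑ n ∈ S, Real.log ((n ^ 3 + 2 : ℕ) : ℝ) :=
      sum_le_sum (fun n hn => (log_cube_add_two_bounds hn).1)
    rw [sum_const, hcardS, nsmul_eq_mul] at h1
    rw [sum_sub_distrib]
    linarith
  -- pointwise upper bounds on the three classes
  have hPbound : ∀ n ∈ Pset, Real.log ((n ^ 3 + 2 : ℕ) : ℝ) -
        (∑ p ∈ Nat.primesLE (3 * X), ((n ^ 3 + 2).factorization p : ℝ) * Real.log p) ≤
      3 * Real.log X + Real.log 10 := fun n hn => by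
    have hnS := (mem_filter.1 hn).1
    have h1 := (log_cube_add_two_bounds hnS).2
    have h2 := smallPart_nonneg X n
    linarith
  have hGbound : ∀ n ∈ GP, Real.log ((n ^ 3 + 2 : ℕ) : ℝ) -
        (∑ p ∈ Nat.primesLE (3 * X), ((n ^ 3 + 2).factorization p : ℝ) * Real.log p) ≤
      (2 - δ) * Real.log X + Real.log 10 := fun n hn => by
    have hnNP := (mem_filter.1 hn).1
    have hg : (1 + δ) * Real.log X ≤
          (∑ p ∈ Nat.primesLE (3 * X), ((n ^ 3 + 2).factorization p : ℝ) * Real.log p)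
          := (mem_filter.1 hn).2
    have h1 := (log_cube_add_two_bounds (mem_filter.1 hnNP).1).2
    linarith
  have hRbound : ∀ n ∈ RP, Real.log ((n ^ 3 + 2 : ℕ) : ℝ) -
        (∑ p ∈ Nat.primesLE (3 * X), ((n ^ 3 + 2).factorization p : ℝ) * Real.log p) ≤
      2 * (1 + α * δ / 2) * Real.log X := fun n hn => by
    have hnNP := (mem_filter.1 hn).1
    have hnS := (mem_filter.1 hnNP).1
    have hnot := (mem_filter.1 hnNP).2
    have hall :
        ∀ p : ℕ, p.Prime → p ∣ n ^ 3 + 2 → (p : ℝ) < (X : ℝ) ^ (1 + α * δ / 2) := by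
      intro p hp hpd
      by_contra hge
      exact hnot ⟨p, hp, hpd, le_of_not_gt hge⟩
    have h := log_sub_smallPart_le_two_mul_log hnS hY1 hall
    rw [hlogY] at h
    linarith
  -- the total large part: upper bound
  have hsplitS : ∑ n ∈ S, (Real.log ((n ^ 3 + 2 : ℕ) : ℝ) -
        (∑ p ∈ Nat.primesLE (3 * X), ((n ^ 3 + 2).factorization p : ℝ) * Real.log p)) =
      ∑ n ∈ Pset, (Real.log ((n ^ 3 + 2 : ℕ) : ℝ) -
            (∑ p ∈ Nat.primesLE (3 * X), ((n ^ 3 + 2).factorization p : ℝ) * Real.log p)) +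
        (∑ n ∈ GP, (Real.log ((n ^ 3 + 2 : ℕ) : ℝ) -
              (∑ p ∈ Nat.primesLE (3 * X), ((n ^ 3 + 2).factorization p : ℝ) * Real.log p)) +
          ∑ n ∈ RP, (Real.log ((n ^ 3 + 2 : ℕ) : ℝ) -
                (∑ p ∈ Nat.primesLE (3 * X), ((n ^ 3 + 2).factorization p : ℝ) * Real.log p))) := by
    rw [hGP, hRP, sum_filter_add_sum_filter_not NP, hPset, hNP, sum_filter_add_sum_filter_not S]
  have hup : ∑ n ∈ S, (Real.log ((n ^ 3 + 2 : ℕ) : ℝ) -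
        (∑ p ∈ Nat.primesLE (3 * X), ((n ^ 3 + 2).factorization p : ℝ) * Real.log p)) ≤
      #Pset * (3 * Real.log X + Real.log 10) + #GP * ((2 - δ) * Real.log X + Real.log 10) +
        #RP * (2 * (1 + α * δ / 2) * Real.log X) := by
    rw [hsplitS]
    have a := sum_le_card_nsmul _ _ _ hPbound
    have b := sum_le_card_nsmul _ _ _ hGbound
    have c := sum_le_card_nsmul _ _ _ hRbound
    rw [nsmul_eq_mul] at a b c
    linarith
  -- the accounting
  have hr : (#RP : ℝ) = X - #Pset - #GP := by
    have e1 : ((#Pset : ℕ) : ℝ) + #NP = X := by rw [← hcardS]; exact_mod_cast hc1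
    have e2 : ((#GP : ℕ) : ℝ) + #RP = #NP := by exact_mod_cast hc2
    linarith
  have hg : α * X - #Pset ≤ (#GP : ℝ) := by
    have : ((#G : ℕ) : ℝ) ≤ #GP + #Pset := by exact_mod_cast hc3
    linarith
  exact accounting hL0 hδ rfl hXpos.le hlow hup hr hg hcoef hLbig

end Irving2015

/-! ### Assembly: Theorem 1.1 from Heath-Brown's sieve output and Irving's tail bound -/

open scoped Classical in
/-- **Irving 2015, Theorem 1.1 from its two analytic inputs** (§2 + §5 of the paper, assembled).
Write `Ω(n) = Ω_δ(n³+2)` for the number of prime factors `p ≥ X^δ` of `n³ + 2` counted with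
multiplicity, `δ = 1/321`, and `σ(n) = ∑_{p ≤ 3X} v_p(n³+2) log p` (`= log^{(1)}(n³+2)`).  Suppose
(A) — Heath-Brown's Lemma 2.3 with his "sufficient condition" and Irving's bound on the weights —
for all large `X` there are weights `W(n) ∈ ℕ` on `n ∈ (X, 2X]` with `∑ W(n) ≥ (9.2·10⁻⁸ − 10⁻⁹)X`,
`W(n) > 0 ⇒ σ(n) ≥ (1+δ) log X`, and `W(n) ≤ min(Ω(n), 321)·2^{Ω(n)}`; and
(B) — Irving's Lemmas 3.2/4.2 with the numerics of §5 — for all large `X`,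
`∑_{132 < h ≤ 963} min(h,321) 2^h T(h) ≤ (3.7·10⁻⁸ + 10⁻⁹)X`, `T(h) = #{n ∈ (X,2X] : Ω(n) ≥ h}`.
Then Theorem 1.1 (`Irving2015_largestPrimeFactor_cubic`) holds.  Proof: `Ω(n) ≤ 963` once
`X^{1/321} > 10` (`card_largePrimeFactors_lt`); `sum_weight_le` with `H = 132` gives
`#{W > 0} ≥ α₀X`, `α₀ = 2^{-132}/132·(5.3·10⁻⁸)`; those `n` are good, so `heathBrown_lemma_2_2`
yields `≫ X` values of `n` with a prime factor `≥ X^{1+α₀δ/2}`, and `α₀δ/2 > 10⁻⁵²`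
(`Irving2015_largestPrimeFactor_cubic_of_count_ge`).  Inputs (A) and (B) are NOT in the tree
(Heath-Brown's paper is not held; Irving's tail bound needs his exponential-integral numerics).
[cite: Irving2014LargestPrimeFactorCubic, §2 and §5] -/
theorem Irving2015_largestPrimeFactor_cubic_of_sieveInputs
    (hA : ∀ᶠ X : ℕ in atTop, ∃ W : ℕ → ℕ,
      (9.2 / 10 ^ 8 - 1 / 10 ^ 9) * (X : ℝ) ≤ ∑ n ∈ Ioc X (2 * X), (W n : ℝ) ∧
      (∀ n ∈ Ioc X (2 * X), 0 < W n → (1 + 1 / 321) * Real.log X ≤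
        ∑ p ∈ Nat.primesLE (3 * X), ((n ^ 3 + 2).factorization p : ℝ) * Real.log p) ∧
      (∀ n ∈ Ioc X (2 * X), W n ≤
        min ((Nat.primeFactorsList (n ^ 3 + 2)).filter
            (fun p => ⌈(X : ℝ) ^ ((1 : ℝ) / 321)⌉₊ ≤ p)).length 321 *
          2 ^ ((Nat.primeFactorsList (n ^ 3 + 2)).filter
            (fun p => ⌈(X : ℝ) ^ ((1 : ℝ) / 321)⌉₊ ≤ p)).length))
    (hB : ∀ᶠ X : ℕ in atTop,
      ∑ h ∈ Ioc (132 : ℕ) 963, ((min h 321 : ℕ) : ℝ) * 2 ^ h *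
          (#((Ioc X (2 * X)).filter fun n : ℕ => h ≤
            ((Nat.primeFactorsList (n ^ 3 + 2)).filter
              (fun p => ⌈(X : ℝ) ^ ((1 : ℝ) / 321)⌉₊ ≤ p)).length) : ℝ) ≤
        (3.7 / 10 ^ 8 + 1 / 10 ^ 9) * X) :
    Irving2015_largestPrimeFactor_cubic := by
  -- the proportion of `n` with positive weight
  set α₀ : ℝ :=
    ((2 : ℝ) ^ 132)⁻¹ / 132 * (9.2 / 10 ^ 8 - 1 / 10 ^ 9 - (3.7 / 10 ^ 8 + 1 / 10 ^ 9)) with hα₀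
  have hα₀pos : 0 < α₀ := by rw [hα₀]; norm_num
  have hδpos : (0 : ℝ) < 1 / 321 := by norm_num
  obtain ⟨X₀, hX₀⟩ := Irving2015.heathBrown_lemma_2_2 hα₀pos hδpos
  have hϖ : (1 : ℝ) / 10 ^ 52 < α₀ * (1 / 321) / 2 := by rw [hα₀]; norm_num
  have hcpos : 0 < α₀ ^ 2 * (1 / 321) / (2 * (1 + 1 / 321)) := by positivity
  refine Irving2015_largestPrimeFactor_cubic_of_count_ge hϖ hcpos ?_
  -- `X` large: `X ≥ X₀`, `X ≥ 1`, and `X^{1/321} > 10`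
  have hlarge : ∀ᶠ X : ℕ in atTop, (10 : ℝ) < (X : ℝ) ^ ((1 : ℝ) / 321) := by
    have h10 : (10 : ℝ) = ((10 : ℝ) ^ (321 : ℕ)) ^ ((1 : ℝ) / 321) := by
      rw [← Real.rpow_natCast, ← Real.rpow_mul (by norm_num)]; norm_num
    filter_upwards [eventually_gt_atTop (10 ^ 321)] with X hX
    rw [h10]
    refine Real.rpow_lt_rpow (by positivity) ?_ (by norm_num)
    exact_mod_cast hX
  filter_upwards [hA, hB, hlarge, eventually_ge_atTop X₀, eventually_ge_atTop 1] with X hAX hBX hX10 hXX₀ hX1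
  obtain ⟨W, hsum, hgood, hWle⟩ := hAX
  set S := Ioc X (2 * X) with hS
  set z : ℕ := ⌈(X : ℝ) ^ ((1 : ℝ) / 321)⌉₊ with hz
  set Ω : ℕ → ℕ :=
    fun n => ((Nat.primeFactorsList (n ^ 3 + 2)).filter (fun p => z ≤ p)).length with hΩ
  have hXpos : (0 : ℝ) < X := by exact_mod_cast hX1
  -- `Ω(n) ≤ 963` on `S`
  have hΩle : ∀ n ∈ S, Ω n ≤ 963 := by
    intro n hn
    rw [hS, mem_Ioc] at hn
    have hzreal : (X : ℝ) ^ ((1 : ℝ) / 321) ≤ (z : ℝ) := Nat.le_ceil _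
    have hz1 : 1 < z := by
      have : (10 : ℝ) < z := hX10.trans_le hzreal
      exact_mod_cast (show (1 : ℝ) < z by linarith)
    have hm : n ^ 3 + 2 < z ^ 964 := by
      have h1 : ((n ^ 3 + 2 : ℕ) : ℝ) ≤ 10 * (X : ℝ) ^ 3 := by
        have : n ^ 3 + 2 ≤ 10 * X ^ 3 := by
          have h2 := Nat.pow_le_pow_left hn.2 3
          have hx3 : 1 ≤ X ^ 3 := Nat.one_le_pow _ _ hX1
          have e1 : (2 * X) ^ 3 = 8 * X ^ 3 := by ring
          rw [e1] at h2; generalize X ^ 3 = Y at h2 hx3 ⊢; omega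
        exact_mod_cast this
      have h2 : 10 * (X : ℝ) ^ 3 < ((X : ℝ) ^ ((1 : ℝ) / 321)) ^ (964 : ℕ) := by
        have e : ((X : ℝ) ^ ((1 : ℝ) / 321)) ^ (964 : ℕ) =
            (X : ℝ) ^ 3 * (X : ℝ) ^ ((1 : ℝ) / 321) := by
          rw [← Real.rpow_natCast, ← Real.rpow_mul hXpos.le]
          rw [show ((1 : ℝ) / 321 * ((964 : ℕ) : ℝ)) = (3 : ℕ) + (1 : ℝ) / 321 by norm_num,
            Real.rpow_add hXpos, Real.rpow_natCast]
        rw [e]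
        have hX3 : (0 : ℝ) < (X : ℝ) ^ 3 := by positivity
        nlinarith
      have h3 : ((X : ℝ) ^ ((1 : ℝ) / 321)) ^ (964 : ℕ) ≤ (z : ℝ) ^ (964 : ℕ) :=
        pow_le_pow_left₀ (by positivity) hzreal _
      exact_mod_cast (h1.trans_lt (h2.trans_le h3))
    have := Irving2015.card_largePrimeFactors_lt (m := n ^ 3 + 2) (by positivity) hz1 hm
    simpa [hΩ] using Nat.lt_succ_iff.1 this
  -- the truncation inequality with `H = 132`, `M = 321`, `B = 963`
  have hWle' : ∀ n ∈ S, W n ≤ min (Ω n) 321 * 2 ^ Ω n := fun n hn => hWle n hn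
  have key := Irving2015.sum_weight_le S W Ω 321 132 963 hWle' hΩle
  have keyR : (∑ n ∈ S, (W n : ℝ)) ≤
      ((min 132 321 : ℕ) : ℝ) * 2 ^ 132 * (#(S.filter fun n => 0 < W n) : ℝ) +
        ∑ h ∈ Ioc (132 : ℕ) 963, ((min h 321 : ℕ) : ℝ) * 2 ^ h *
          (#(S.filter fun n : ℕ => h ≤ Ω n) : ℝ) := by
    have := (Nat.cast_le (α := ℝ)).2 key
    simpa only [Nat.cast_sum, Nat.cast_add, Nat.cast_mul, Nat.cast_pow, Nat.cast_ofNat] using this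
  have hBX' : ∑ h ∈ Ioc (132 : ℕ) 963, ((min h 321 : ℕ) : ℝ) * 2 ^ h *
      (#(S.filter fun n : ℕ => h ≤ Ω n) : ℝ) ≤ (3.7 / 10 ^ 8 + 1 / 10 ^ 9) * X := hBX
  -- hence `α₀ X ≤ #{W > 0} ≤ #{good n}`
  have hpos : α₀ * X ≤ (#(S.filter fun n => 0 < W n) : ℝ) := by
    have hmin : ((min 132 321 : ℕ) : ℝ) = 132 := by norm_num
    rw [hmin] at keyR
    rw [hα₀]
    have h2 : (0 : ℝ) < 132 * 2 ^ 132 := by positivity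
    have h3 : (9.2 / 10 ^ 8 - 1 / 10 ^ 9 - (3.7 / 10 ^ 8 + 1 / 10 ^ 9)) * (X : ℝ) ≤
        132 * 2 ^ 132 * (#(S.filter fun n => 0 < W n) : ℝ) := by linarith
    calc ((2 : ℝ) ^ 132)⁻¹ / 132 * (9.2 / 10 ^ 8 - 1 / 10 ^ 9 - (3.7 / 10 ^ 8 + 1 / 10 ^ 9)) *
          (X : ℝ)
        = ((9.2 / 10 ^ 8 - 1 / 10 ^ 9 - (3.7 / 10 ^ 8 + 1 / 10 ^ 9)) * (X : ℝ)) /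
            (132 * 2 ^ 132) := by
          ring
      _ ≤ (#(S.filter fun n => 0 < W n) : ℝ) := by rw [div_le_iff₀ h2]; linarith
  have hgood' : α₀ * X ≤ #(S.filter fun n : ℕ => (1 + 1 / 321) * Real.log X ≤
      ∑ p ∈ Nat.primesLE (3 * X), ((n ^ 3 + 2).factorization p : ℝ) * Real.log p) := by
    refine hpos.trans ?_
    exact_mod_cast card_le_card (fun n hn => by
      rw [mem_filter] at hn ⊢
      exact ⟨hn.1, hgood n hn.1 hn.2⟩)
  exact hX₀ X hXX₀ hgood'


/-! ### Assembly, second form: the `h ≥ 190` tail through Lemma 3.2 -/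

set_option exponentiation.threshold 1024 in
open scoped Classical in
/-- **Irving 2015, Theorem 1.1 from Heath-Brown's sieve output, Irving's second estimate on
`133 ≤ h ≤ 189`, and one numerical inequality.**  As `Irving2015_largestPrimeFactor_cubic_of_sieveInputs`,
but with the tail `190 ≤ h ≤ 963` of input (B) discharged by the (proved) Lemma 3.2
(`Irving2015.irving_lemma_3_2`): what remains of (B) is
(B') `∑_{132<h≤189} min(h,321) 2^h T(h) ≤ (3.6·10⁻⁸ + 10⁻¹⁰)X` for large `X` (Irving's Lemma 4.2
with `K = [h/3] + 20` and optimised `α_k`, §5: "`≤ X(3.6 × 10⁻⁸ + o(1))`"), and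
(N) the numerical inequality `∑_{189<h≤963} min(h,321) 2^h c(h, 1/321) ≤ 9.2·10⁻¹⁰` with
`c(h,δ) = (log((3−(k−1)δ)/((h−k+1)δ)))^k/k!`, `k = [h/3]` (§5: "`≤ X(9.2 × 10⁻¹⁰ + o(1))`";
numerically the left side is `9.138…·10⁻¹⁰`). [cite: Irving2014LargestPrimeFactorCubic, §5] -/
theorem Irving2015_largestPrimeFactor_cubic_of_sieveInputs'
    (hA : ∀ᶠ X : ℕ in atTop, ∃ W : ℕ → ℕ,
      (9.2 / 10 ^ 8 - 1 / 10 ^ 9) * (X : ℝ) ≤ ∑ n ∈ Ioc X (2 * X), (W n : ℝ) ∧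
      (∀ n ∈ Ioc X (2 * X), 0 < W n → (1 + 1 / 321) * Real.log X ≤
        ∑ p ∈ Nat.primesLE (3 * X), ((n ^ 3 + 2).factorization p : ℝ) * Real.log p) ∧
      (∀ n ∈ Ioc X (2 * X), W n ≤
        min ((Nat.primeFactorsList (n ^ 3 + 2)).filter
            (fun p => ⌈(X : ℝ) ^ ((1 : ℝ) / 321)⌉₊ ≤ p)).length 321 *
          2 ^ ((Nat.primeFactorsList (n ^ 3 + 2)).filter
            (fun p => ⌈(X : ℝ) ^ ((1 : ℝ) / 321)⌉₊ ≤ p)).length))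
    (hB' : ∀ᶠ X : ℕ in atTop,
      ∑ h ∈ Ioc (132 : ℕ) 189, ((min h 321 : ℕ) : ℝ) * 2 ^ h *
          (#((Ioc X (2 * X)).filter fun n : ℕ => h ≤
            ((Nat.primeFactorsList (n ^ 3 + 2)).filter
              (fun p => ⌈(X : ℝ) ^ ((1 : ℝ) / 321)⌉₊ ≤ p)).length) : ℝ) ≤
        (3.6 / 10 ^ 8 + 1 / 10 ^ 10) * X)
    (hN : ∑ h ∈ Ioc (189 : ℕ) 963, ((min h 321 : ℕ) : ℝ) * 2 ^ h *
        ((Real.log ((3 - ((h / 3 - 1 : ℕ) : ℝ) * ((1 : ℝ) / 321)) /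
            (((h - h / 3 + 1 : ℕ) : ℝ) * ((1 : ℝ) / 321)))) ^ (h / 3) / (h / 3).factorial) ≤
      9.2 / 10 ^ 10) :
    Irving2015_largestPrimeFactor_cubic := by
  refine Irving2015_largestPrimeFactor_cubic_of_sieveInputs hA ?_
  -- the slack `ε₀` for the 774 values of `h`
  set ε₀ : ℝ := (5 / 10 ^ 10) / (321 * 2 ^ 964) with hε₀
  have hε₀pos : 0 < ε₀ := by rw [hε₀]; positivity
  -- Lemma 3.2 for each `190 ≤ h ≤ 963`
  have hev : ∀ h ∈ Ioc (189 : ℕ) 963, ∀ᶠ X : ℕ in atTop,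
      (#((Ioc X (2 * X)).filter fun n : ℕ => h ≤
          ((Nat.primeFactorsList (n ^ 3 + 2)).filter
            (fun p => ⌈(X : ℝ) ^ ((1 : ℝ) / 321)⌉₊ ≤ p)).length) : ℝ) ≤
        ((Real.log ((3 - ((h / 3 - 1 : ℕ) : ℝ) * ((1 : ℝ) / 321)) /
            (((h - h / 3 + 1 : ℕ) : ℝ) * ((1 : ℝ) / 321)))) ^ (h / 3) / (h / 3).factorial + ε₀) *
          X := by
    intro h hh
    rw [mem_Ioc] at hh
    refine Irving2015.irving_lemma_3_2 (by norm_num) (by norm_num) (by omega) ?_ hε₀pos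
    -- `(h − k + 1)/321 ≤ 3 − (k − 1)/321` iff `h ≤ 963`
    have h1 : ((h - h / 3 + 1 : ℕ) : ℝ) + ((h / 3 - 1 : ℕ) : ℝ) = h := by
      have : (h - h / 3 + 1) + (h / 3 - 1) = h := by omega
      exact_mod_cast this
    have h2 : (h : ℝ) ≤ 963 := by exact_mod_cast hh.2
    nlinarith [h1, h2]
  rw [← Filter.eventually_all_finset] at hev
  filter_upwards [hB', hev] with X hlow hhigh
  have hX0 : (0 : ℝ) ≤ X := Nat.cast_nonneg X
  rw [← sum_Ioc_consecutive _ (by norm_num : (132 : ℕ) ≤ 189) (by norm_num : (189 : ℕ) ≤ 963)]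
  -- the tail
  have htail : ∑ h ∈ Ioc (189 : ℕ) 963, ((min h 321 : ℕ) : ℝ) * 2 ^ h *
      (#((Ioc X (2 * X)).filter fun n : ℕ => h ≤
        ((Nat.primeFactorsList (n ^ 3 + 2)).filter
          (fun p => ⌈(X : ℝ) ^ ((1 : ℝ) / 321)⌉₊ ≤ p)).length) : ℝ) ≤
      (9.2 / 10 ^ 10) * X + (5 / 10 ^ 10) * X := by
    calc ∑ h ∈ Ioc (189 : ℕ) 963, ((min h 321 : ℕ) : ℝ) * 2 ^ h *
          (#((Ioc X (2 * X)).filter fun n : ℕ => h ≤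
            ((Nat.primeFactorsList (n ^ 3 + 2)).filter
              (fun p => ⌈(X : ℝ) ^ ((1 : ℝ) / 321)⌉₊ ≤ p)).length) : ℝ)
        ≤ ∑ h ∈ Ioc (189 : ℕ) 963, ((min h 321 : ℕ) : ℝ) * 2 ^ h *
            (((Real.log ((3 - ((h / 3 - 1 : ℕ) : ℝ) * ((1 : ℝ) / 321)) /
              (((h - h / 3 + 1 : ℕ) : ℝ) * ((1 : ℝ) / 321)))) ^ (h / 3) / (h / 3).factorial + ε₀) *
              X) := by
          refine sum_le_sum (fun h hh => ?_)
          exact mul_le_mul_of_nonneg_left (hhigh h hh) (by positivity)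
      _ = (∑ h ∈ Ioc (189 : ℕ) 963, ((min h 321 : ℕ) : ℝ) * 2 ^ h *
            ((Real.log ((3 - ((h / 3 - 1 : ℕ) : ℝ) * ((1 : ℝ) / 321)) /
              (((h - h / 3 + 1 : ℕ) : ℝ) * ((1 : ℝ) / 321)))) ^ (h / 3) / (h / 3).factorial)) * X +
            ε₀ * (∑ h ∈ Ioc (189 : ℕ) 963, ((min h 321 : ℕ) : ℝ) * 2 ^ h) * X := by
          rw [sum_mul, mul_sum, sum_mul, ← sum_add_distrib]
          refine sum_congr rfl (fun h _ => ?_)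
          ring
      _ ≤ (9.2 / 10 ^ 10) * X + ε₀ * (321 * 2 ^ 964) * X := by
          have hgeo : ∑ h ∈ Ioc (189 : ℕ) 963, ((min h 321 : ℕ) : ℝ) * 2 ^ h ≤ 321 * 2 ^ 964 := by
            calc ∑ h ∈ Ioc (189 : ℕ) 963, ((min h 321 : ℕ) : ℝ) * 2 ^ h
                ≤ ∑ h ∈ Ioc (189 : ℕ) 963, (321 : ℝ) * 2 ^ h := by
                  refine sum_le_sum (fun h _ => ?_)
                  have : ((min h 321 : ℕ) : ℝ) ≤ 321 := by exact_mod_cast min_le_right h 321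
                  exact mul_le_mul_of_nonneg_right this (by positivity)
              _ = 321 * ∑ h ∈ Ioc (189 : ℕ) 963, (2 : ℝ) ^ h := by rw [mul_sum]
              _ ≤ 321 * ∑ h ∈ range 964, (2 : ℝ) ^ h := by
                  refine mul_le_mul_of_nonneg_left ?_ (by norm_num)
                  refine sum_le_sum_of_subset_of_nonneg (fun h hh => ?_) (fun _ _ _ => by positivity)
                  rw [mem_Ioc] at hh; rw [mem_range]; omega
              _ ≤ 321 * 2 ^ 964 := by
                  rw [geom_sum_eq (by norm_num : (2 : ℝ) ≠ 1)]
                  norm_num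
          gcongr
      _ = (9.2 / 10 ^ 10) * X + (5 / 10 ^ 10) * X := by
          rw [hε₀]; field_simp
  have hfinal : (3.6 / 10 ^ 8 + 1 / 10 ^ 10) * (X : ℝ) + ((9.2 / 10 ^ 10) * X + (5 / 10 ^ 10) * X) ≤
      (3.7 / 10 ^ 8 + 1 / 10 ^ 9) * X := by nlinarith [hX0]
  exact (add_le_add hlow htail).trans hfinal

end Literature.NumberTheory.Sieve
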